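import Literature.NumberTheory.QuadraticFields.RedeiMatrixFourRank
import Literature.NumberTheory.QuadraticFields.RedeiReichardtDiscriminant
import Mathlib.NumberTheory.LegendreSymbol.JacobiSymbol
import Mathlib.NumberTheory.LegendreSymbol.ZModChar
import HarnessLib

/-!
# The Rédei matrix of Li–Ma is the transpose of the matrix of genus-character values

Topic `NumberTheory/QuadraticFields`, namespace `Literature.NumberTheory.QuadraticFields.RedeiReichardt`
(towards `redeiReichardt_fourTwoCard_classGroup`, Li–Ma 2008 Def. 0.2 / Thm. 0.4; Stevenhagen 1995
§2: Stevenhagen's `R = (χᵢ(pⱼ))` is the transpose of Li–Ma's `RM(D) = ((Dⱼ/pᵢ))`).  Theorem-only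
file (no definition, no named fact); elementary number theory only (quadratic reciprocity and its
supplements).

For the prime tuple `p₁, …, p_t` of `D = disc ℚ(√-n)` and the prime discriminants `Dᵢ = primeDisc n pᵢ`
(Li–Ma Lemma 0.1):

* `prod_primeDisc_eq` — **`∏ᵢ Dᵢ = D`** (`= -n` for `n ≡ 3 (mod 4)`, `-4n` otherwise);
* `jacobiSym_primeDisc_eq` — **quadratic reciprocity in the form `(pᵢ*/q) = (q/pᵢ)`** for odd primes
  `q ≠ pᵢ`, `pᵢ* = Dᵢ = (-1)^{(pᵢ-1)/2} pᵢ`; `kroneckerBit_primeDisc_two` — `(Dᵢ/2) = (2/pᵢ)`;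
* `jacobiSym_prod_primeDisc_erase` — `(∏_{k ≠ i} D_k / pᵢ) = ((n/pᵢ) / pᵢ)` (from `∏ D_k = D`,
  `(4/p) = 1` and `(-χ₄(p) / p) = 1`);
* `redeiMatrix_transpose_apply` — **`RM(D)ⱼᵢ = [ψ_{pᵢ}([𝔭ⱼ]) = -1]`** for odd `pᵢ`: the `(j, i)` entry of
  Li–Ma's matrix is `[(pⱼ/pᵢ) = -1]` for `j ≠ i` and `[((n/pᵢ)/pᵢ) = -1]` for `j = i` — the values of
  the genus character `ψ_{pᵢ}` on the ramified prime classes (`RedeiReichardtGenusValues.lean`).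

## References

* Y. Li, L. Ma, Acta Arith. 134 (2008), Lemma 0.1, Def. 0.2. [LiMa2008]
* P. Stevenhagen, *Rédei-matrices and applications*, LMS LNS 215 (1995), §2. [Stevenhagen1995RedeiMatrices]
* K. Ireland, M. Rosen, *A classical introduction to modern number theory*, GTM 84, Ch. 5 (quadratic
  reciprocity and its supplements). [IrelandRosen1990]
-/

noncomputable section

open ZMod

namespace Literature.NumberTheory.QuadraticFields.RedeiReichardt

/-! ### Bits and signs -/

/-- In `𝔽₂`: `x = [c]` iff (`x = 1 ↔ c`). [folklore] -/
private theorem eq_ite_iff {x : ZMod 2} {c : Prop} [Decidable c] :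
    x = (if c then 1 else 0) ↔ (x = 1 ↔ c) := by
  constructor
  · rintro rfl
    by_cases hc : c
    · rw [if_pos hc]; exact ⟨fun _ => hc, fun _ => rfl⟩
    · rw [if_neg hc]; exact ⟨fun h => absurd h zero_ne_one, fun h => absurd h hc⟩
  · intro h
    by_cases hc : c
    · rw [if_pos hc]; exact h.mpr hc
    · rw [if_neg hc]
      have hx : x ≠ 1 := fun h1 => hc (h.mp h1)
      fin_cases x
      · rfl
      · exact absurd rfl hx

/-- For an odd prime `p` and `a` prime to `p`: `kroneckerBit a p = [(a/p) = -1]`.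
[cite: IrelandRosen1990, Ch. 5 §1 Prop. 5.1.2 (Euler's criterion)] -/
theorem kroneckerBit_eq_ite {a : ℤ} {p : ℕ} (hp : p.Prime) (hp2 : p ≠ 2) (ha : ((a : ZMod p)) ≠ 0) :
    kroneckerBit a p = if jacobiSym a p = -1 then 1 else 0 := by
  rw [eq_ite_iff]
  exact kroneckerBit_eq_one_iff_jacobiSym hp hp2 ha

/-- A product of signs `±1` is a sign. [folklore] -/
private theorem prod_eq_one_or_neg_one {ι : Type*} (S : Finset ι) {s : ι → ℤ}
    (hs : ∀ k ∈ S, s k = 1 ∨ s k = -1) : ∏ k ∈ S, s k = 1 ∨ ∏ k ∈ S, s k = -1 := by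
  classical
  induction S using Finset.induction_on with
  | empty => simp
  | insert a S ha ih =>
    rw [Finset.prod_insert ha]
    rcases hs a (Finset.mem_insert_self a S) with h | h <;>
      (rcases ih (fun k hk => hs k (Finset.mem_insert_of_mem hk)) with h' | h' <;> simp [h, h'])

/-- Additivity of the bit `[s = -1]` over products of signs `s ∈ {±1}`: `Σ_k [s_k = -1] = [∏ s_k = -1]`
in `𝔽₂`. [folklore] -/
private theorem sum_ite_eq_ite_prod {ι : Type*} (S : Finset ι) {s : ι → ℤ}
    (hs : ∀ k ∈ S, s k = 1 ∨ s k = -1) :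
    ∑ k ∈ S, (if s k = -1 then (1 : ZMod 2) else 0) = if ∏ k ∈ S, s k = -1 then 1 else 0 := by
  classical
  induction S using Finset.induction_on with
  | empty => simp
  | insert a S ha ih =>
    have hs' : ∀ k ∈ S, s k = 1 ∨ s k = -1 := fun k hk => hs k (Finset.mem_insert_of_mem hk)
    rw [Finset.sum_insert ha, Finset.prod_insert ha, ih hs']
    rcases hs a (Finset.mem_insert_self a S) with h | h <;>
      rcases prod_eq_one_or_neg_one S hs' with h' | h' <;> (simp [h, h']; try decide)

/-- Multiplicativity of the Jacobi symbol in the numerator, over a `Finset`. [folklore] -/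
private theorem prod_jacobiSym_eq' {ι : Type*} (s : Finset ι) (f : ι → ℤ) (b : ℕ) :
    ∏ j ∈ s, jacobiSym (f j) b = jacobiSym (∏ j ∈ s, f j) b := by
  classical
  induction s using Finset.induction_on with
  | empty => simp [jacobiSym.one_left]
  | insert a s ha ih => rw [Finset.prod_insert ha, Finset.prod_insert ha, jacobiSym.mul_left, ih]

/-- `gcd(a, q) = 1` for a prime `q ∤ a`. [folklore] -/
private theorem gcd_eq_one_of_not_dvd {a : ℤ} {q : ℕ} (hq : q.Prime) (h : ¬ (q : ℤ) ∣ a) :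
    a.gcd q = 1 := by
  have h1 : (Int.gcd a q : ℤ) ∣ (q : ℤ) := Int.gcd_dvd_right a q
  have h1' : Int.gcd a q ∣ q := by exact_mod_cast h1
  rcases (Nat.dvd_prime hq).mp h1' with h2 | h2
  · exact h2
  · exfalso
    apply h
    have h3 : (Int.gcd a q : ℤ) ∣ a := Int.gcd_dvd_left a q
    rwa [h2] at h3

/-! ### The prime discriminants -/

/-- For an odd prime `p`: `primeDisc n p = χ₄(p) · p` (`= p` for `p ≡ 1`, `-p` for `p ≡ 3 (mod 4)`).
[cite: LiMa2008, Lemma 0.1] -/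
theorem primeDisc_eq_χ₄_mul (n : ℕ) {p : ℕ} (hp : p.Prime) (hp2 : p ≠ 2) :
    primeDisc n p = χ₄ p * p := by
  have hodd : p % 2 = 1 := Nat.odd_iff.mp (hp.odd_of_ne_two hp2)
  have h2 : ¬ p % 2 = 0 := by omega
  rw [χ₄_nat_eq_if_mod_four, if_neg h2, primeDisc_of_ne_two n hp2]
  by_cases h4 : p % 4 = 1
  · rw [if_pos h4, if_pos h4, one_mul]
  · rw [if_neg h4, if_neg h4, neg_one_mul]

/-- Over the odd primes of a tuple: `∏ D_k = χ₄(∏ p_k) · ∏ p_k`. [cite: LiMa2008, Lemma 0.1] -/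
theorem prod_primeDisc_odd {t : ℕ} {p : Fin t → ℕ} (hp : ∀ i, (p i).Prime) (n : ℕ) (S : Finset (Fin t))
    (hS : ∀ k ∈ S, p k ≠ 2) :
    ∏ k ∈ S, primeDisc n (p k) = χ₄ ((∏ k ∈ S, p k : ℕ) : ZMod 4) * ((∏ k ∈ S, p k : ℕ) : ℤ) := by
  rw [Finset.prod_congr rfl fun k hk => primeDisc_eq_χ₄_mul n (hp k) (hS k hk), Finset.prod_mul_distrib,
    Nat.cast_prod, Nat.cast_prod, map_prod]

section Tuple

variable {t : ℕ} {p : Fin t → ℕ} (hp : ∀ i, (p i).Prime) (hinj : Function.Injective p)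
  {n : ℕ} (hprod : ∏ i, p i = if n % 4 = 1 then 2 * n else n)
include hp hinj hprod

omit hprod in
/-- **`pⱼ ∤ D_k` for `j ≠ k`, `pⱼ` odd** (`D_k = ±p_k`, or `∈ {-4, 8, -8}` for `p_k = 2`).
[cite: LiMa2008, Lemma 0.1] -/
theorem not_dvd_primeDisc {j k : Fin t} (hjk : j ≠ k) (hj2 : p j ≠ 2) :
    ¬ ((p j : ℕ) : ℤ) ∣ primeDisc n (p k) := by
  intro hdvd
  by_cases hk2 : p k = 2
  · rw [hk2] at hdvd
    have h8 : ((p j : ℕ) : ℤ) ∣ 8 := by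
      unfold primeDisc at hdvd
      rw [if_pos rfl] at hdvd
      split_ifs at hdvd
      · exact (Int.dvd_neg.mp hdvd).trans ⟨2, by norm_num⟩
      · exact hdvd
      · exact Int.dvd_neg.mp hdvd
    have h8' : p j ∣ 2 ^ 3 := by exact_mod_cast h8
    exact hj2 ((Nat.prime_dvd_prime_iff_eq (hp j) Nat.prime_two).mp ((hp j).dvd_of_dvd_pow h8'))
  · rw [primeDisc_of_ne_two n hk2] at hdvd
    have hkj : ((p j : ℕ) : ℤ) ∣ p k := by
      split_ifs at hdvd
      · exact hdvd
      · exact Int.dvd_neg.mp hdvd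
    have := (Nat.prime_dvd_prime_iff_eq (hp j) (hp k)).mp (by exact_mod_cast hkj)
    exact hjk (hinj this)

/-- **`∏ᵢ Dᵢ = D`** (Li–Ma Lemma 0.1: "`D` can be uniquely decomposed as `D = D₁⋯D_t`"): the product of
the prime discriminants of the tuple is `-n` (`n ≡ 3 (mod 4)`) resp. `-4n`. [cite: LiMa2008, Lemma 0.1] -/
theorem prod_primeDisc_eq : ∏ k, primeDisc n (p k) = if n % 4 = 3 then -(n : ℤ) else -4 * n := by
  classical
  obtain ⟨hn, hn0⟩ := squarefree_and_pos_of_prod_eq hp hinj hprod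
  have h4 : ¬ 4 ∣ n := fun h => by
    obtain ⟨k, rfl⟩ := h
    have : 2 * 2 ∣ 4 * k := ⟨k, by ring⟩
    exact absurd (Nat.isUnit_iff.mp (hn 2 this)) (by norm_num)
  by_cases h3 : n % 4 = 3
  · -- all primes odd, `∏ p_k = n`, `χ₄(n) = -1`
    rw [if_pos h3]
    have hodd : ∀ k ∈ (Finset.univ : Finset (Fin t)), p k ≠ 2 := fun k _ h2k => by
      rcases dvd_or_of_prod_eq hp hprod k with h | ⟨-, h1⟩
      · rw [h2k] at h; omega
      · omega
    rw [prod_primeDisc_odd hp n _ hodd, hprod, if_neg (by omega), χ₄_nat_three_mod_four h3]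
    ring
  · rw [if_neg h3]
    -- the prime `2` is in the tuple
    obtain ⟨k₀, hk₀⟩ : ∃ k, p k = 2 := by
      by_cases h1 : n % 4 = 1
      · exact exists_eq_two_of_prod_eq hp hprod h1
      · exact exists_eq_of_prime_dvd hp hprod Nat.prime_two (by omega)
    have hodd : ∀ k ∈ Finset.univ.erase k₀, p k ≠ 2 := fun k hk h2k =>
      Finset.ne_of_mem_erase hk (hinj (h2k.trans hk₀.symm))
    rw [← Finset.mul_prod_erase _ _ (Finset.mem_univ k₀), prod_primeDisc_odd hp n _ hodd, hk₀]
    -- `2 · ∏_{k ≠ k₀} p_k = ∏ p_k`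
    have hrest : 2 * ∏ k ∈ Finset.univ.erase k₀, p k = ∏ k, p k := by
      rw [← hk₀, Finset.mul_prod_erase _ _ (Finset.mem_univ k₀)]
    rw [hprod] at hrest
    set n' := ∏ k ∈ Finset.univ.erase k₀, p k with hn'
    have hD2 : primeDisc n 2 = if n % 4 = 1 then -4 else if n % 8 = 6 then 8 else -8 := by
      simp [primeDisc]
    rw [hD2]
    by_cases h1 : n % 4 = 1
    · rw [if_pos h1] at hrest ⊢
      have hrest' : n' = n := by omega
      rw [hrest', χ₄_nat_one_mod_four h1]
      ring
    · rw [if_neg h1] at hrest ⊢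
      have hn2 : n = 2 * n' := hrest.symm
      by_cases h6 : n % 8 = 6
      · have hn'3 : n' % 4 = 3 := by omega
        rw [if_pos h6, χ₄_nat_three_mod_four hn'3, hn2]
        push_cast
        ring
      · have hn'1 : n' % 4 = 1 := by omega
        rw [if_neg h6, χ₄_nat_one_mod_four hn'1, hn2]
        push_cast
        ring

/-! ### Quadratic reciprocity for the prime discriminants -/

omit hinj hprod in
/-- **`(pᵢ*/q) = (q/pᵢ)`** for odd primes `q ≠ pᵢ` (`pᵢ* = Dᵢ = χ₄(pᵢ) pᵢ`): quadratic reciprocity with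
the first supplement. [cite: IrelandRosen1990, Ch. 5 §2 Thm. 1 (quadratic reciprocity)] -/
theorem jacobiSym_primeDisc_eq {i : Fin t} (hi2 : p i ≠ 2) {q : ℕ} (hq : q.Prime) (hq2 : q ≠ 2) :
    jacobiSym (primeDisc n (p i)) q = jacobiSym q (p i) := by
  have hpodd : Odd (p i) := (hp i).odd_of_ne_two hi2
  have hqodd : Odd q := hq.odd_of_ne_two hq2
  have hpm : p i % 2 = 1 := Nat.odd_iff.mp hpodd
  have hqm : q % 2 = 1 := Nat.odd_iff.mp hqodd
  have hp2' : ¬ p i % 2 = 0 := by omega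
  have hq2' : ¬ q % 2 = 0 := by omega
  rw [primeDisc_eq_χ₄_mul n (hp i) hi2, jacobiSym.mul_left, χ₄_nat_eq_if_mod_four, if_neg hp2']
  by_cases hp1 : p i % 4 = 1
  · rw [if_pos hp1, jacobiSym.one_left, one_mul]
    exact_mod_cast jacobiSym.quadratic_reciprocity_one_mod_four hp1 hqodd
  · have hp3 : p i % 4 = 3 := by omega
    rw [if_neg hp1, jacobiSym.at_neg_one hqodd, χ₄_nat_eq_if_mod_four, if_neg hq2']
    by_cases hq1 : q % 4 = 1
    · rw [if_pos hq1, one_mul]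
      exact_mod_cast (jacobiSym.quadratic_reciprocity_one_mod_four hq1 hpodd).symm
    · have hq3 : q % 4 = 3 := by omega
      rw [if_neg hq1, neg_one_mul]
      have h := jacobiSym.quadratic_reciprocity_three_mod_four hp3 hq3
      have h' : jacobiSym (p i : ℤ) q = -jacobiSym (q : ℤ) (p i) := by exact_mod_cast h
      rw [h', neg_neg]

omit hinj hprod in
/-- **`(Dᵢ/2) = (2/pᵢ)`** for odd `pᵢ`, as bits: Cox's Kronecker symbol `(D/2) = -1 ⟺ D ≡ 5 (mod 8)`,
and `pᵢ* ≡ 5 (mod 8)` iff `pᵢ ≡ ±3 (mod 8)` iff `(2/pᵢ) = -1` (second supplement).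
[cite: IrelandRosen1990, Ch. 5 §1 Prop. 5.1.3 (second supplement)] [cite: LiMa2008, Def. 0.2] -/
theorem kroneckerBit_primeDisc_two {i : Fin t} (hi2 : p i ≠ 2) :
    kroneckerBit (primeDisc n (p i)) 2 = if jacobiSym 2 (p i) = -1 then 1 else 0 := by
  have hpodd : Odd (p i) := (hp i).odd_of_ne_two hi2
  have hpm : p i % 2 = 1 := Nat.odd_iff.mp hpodd
  have hJ : jacobiSym 2 (p i) = -1 ↔ (p i % 8 = 3 ∨ p i % 8 = 5) := by
    rw [jacobiSym.at_two hpodd, χ₈_nat_eq_if_mod_eight]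
    have h2 : ¬ p i % 2 = 0 := by omega
    rw [if_neg h2]
    by_cases h : p i % 8 = 1 ∨ p i % 8 = 7
    · rw [if_pos h]
      constructor
      · intro h'; norm_num at h'
      · intro h'; omega
    · rw [if_neg h]
      constructor
      · intro _; omega
      · intro _; rfl
  have hD : primeDisc n (p i) % 8 = 5 ↔ (p i % 8 = 3 ∨ p i % 8 = 5) := by
    rw [primeDisc_of_ne_two n hi2]
    split_ifs with h4 <;> omega
  rw [kroneckerBit_two]
  by_cases hc : p i % 8 = 3 ∨ p i % 8 = 5
  · rw [if_pos (hD.mpr hc), if_pos (hJ.mpr hc)]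
  · rw [if_neg (fun h => hc (hD.mp h)), if_neg (fun h => hc (hJ.mp h))]

/-- **`(∏_{k ≠ i} D_k / pᵢ) = ((n/pᵢ)/pᵢ)`** for odd `pᵢ`: `∏_{k ≠ i} D_k = D/Dᵢ = -χ₄(pᵢ)·c·(n/pᵢ)` with
`c ∈ {1, 4}`, and `(-χ₄(p)/p) = 1`, `(4/p) = 1`. [cite: LiMa2008, Lemma 0.1 and Def. 0.2] -/
theorem jacobiSym_prod_primeDisc_erase {i : Fin t} (hi2 : p i ≠ 2) :
    jacobiSym (∏ k ∈ Finset.univ.erase i, primeDisc n (p k)) (p i) =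
      jacobiSym ((n / p i : ℕ) : ℤ) (p i) := by
  classical
  obtain ⟨hn, hn0⟩ := squarefree_and_pos_of_prod_eq hp hinj hprod
  have hpodd : Odd (p i) := (hp i).odd_of_ne_two hi2
  have hpm : p i % 2 = 1 := Nat.odd_iff.mp hpodd
  have hin : p i ∣ n := by
    rcases dvd_or_of_prod_eq hp hprod i with h | ⟨h2i, -⟩
    · exact h
    · exact absurd h2i hi2
  obtain ⟨m, hm⟩ := hin
  have hmdiv : n / p i = m := by rw [hm, Nat.mul_div_cancel_left _ (hp i).pos]
  -- `D_i · ∏_{k ≠ i} D_k = D = -c·n`, `D_i = χ₄(p_i) p_i`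
  have hD := prod_primeDisc_eq hp hinj hprod
  rw [← Finset.mul_prod_erase _ _ (Finset.mem_univ i), primeDisc_eq_χ₄_mul n (hp i) hi2,
    χ₄_nat_eq_if_mod_four, if_neg (show ¬ p i % 2 = 0 by omega)] at hD
  set R := ∏ k ∈ Finset.univ.erase i, primeDisc n (p k) with hR
  have hnZ : (n : ℤ) = (p i : ℤ) * (m : ℤ) := by rw [hm]; push_cast; ring
  have key : R = (if p i % 4 = 1 then -1 else 1) * ((if n % 4 = 3 then 1 else 4) * m) := by
    have hp0 : (p i : ℤ) ≠ 0 := by exact_mod_cast (hp i).ne_zero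
    apply mul_left_cancel₀ hp0
    rw [hnZ] at hD
    split_ifs at hD ⊢ <;> linarith
  rw [key, hmdiv, jacobiSym.mul_left, jacobiSym.mul_left]
  -- `(±1 / p) · (c / p) = 1`
  have h1 : jacobiSym (if p i % 4 = 1 then -1 else 1) (p i) = 1 := by
    split_ifs with h
    · rw [jacobiSym.at_neg_one hpodd, χ₄_nat_one_mod_four h]
    · exact jacobiSym.one_left _
  have h2 : jacobiSym (if n % 4 = 3 then 1 else 4) (p i) = 1 := by
    split_ifs with h
    · exact jacobiSym.one_left _
    · rw [show (4 : ℤ) = 2 ^ 2 by norm_num]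
      refine jacobiSym.sq_one' ?_
      show Int.gcd ((2 : ℕ) : ℤ) (p i) = 1
      rw [Int.gcd_natCast_natCast]
      exact (Nat.coprime_primes Nat.prime_two (hp i)).mpr (Ne.symm hi2)
  rw [h1, h2, one_mul, one_mul]

/-! ### The entries of the transposed Rédei matrix -/

/-- **The transposed Rédei matrix as character values**: for odd `pᵢ` and every `j`,
`RM(D)ⱼᵢ = [(pⱼ/pᵢ) = -1]` (`j ≠ i`) resp. `RM(D)ᵢᵢ = [((n/pᵢ)/pᵢ) = -1]` — Li–Ma's matrix (Def. 0.2,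
`r_ji = [(D_i/p_j) = -1]`, `r_ii = Σ_{k ≠ i} r_ik`) read through quadratic reciprocity and `∏ D_k = D`.
These are the values `[ψ_{pᵢ}([𝔭ⱼ]) = -1]` of the genus character `ψ_{pᵢ}` (Stevenhagen's matrix is the
transpose of Li–Ma's). [cite: LiMa2008, Def. 0.2] [cite: Stevenhagen1995RedeiMatrices, §2 Thm. 1] -/
theorem redeiMatrix_transpose_apply {i : Fin t} (hi2 : p i ≠ 2) (j : Fin t) :
    redeiMatrix n p j i =
      if (if j = i then jacobiSym ((n / p i : ℕ) : ℤ) (p i) else jacobiSym (p j) (p i)) = -1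
        then 1 else 0 := by
  classical
  by_cases hji : j = i
  · subst hji
    rw [if_pos rfl, redeiMatrix_apply_self, ← jacobiSym_prod_primeDisc_erase hp hinj hprod hi2,
      ← prod_jacobiSym_eq']
    -- each `r_jk = kroneckerBit (D_k) (p_j) = [(D_k / p_j) = -1]`
    have hbits : ∀ k ∈ Finset.univ.erase j, redeiMatrix n p j k =
        if jacobiSym (primeDisc n (p k)) (p j) = -1 then 1 else 0 := fun k hk => by
      rw [redeiMatrix_apply_of_ne n p (Finset.ne_of_mem_erase hk).symm]
      refine kroneckerBit_eq_ite (hp j) hi2 ?_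
      rw [Ne, ZMod.intCast_zmod_eq_zero_iff_dvd]
      exact not_dvd_primeDisc hp hinj (Finset.ne_of_mem_erase hk).symm hi2
    rw [Finset.sum_congr rfl hbits]
    exact sum_ite_eq_ite_prod _ fun k hk => jacobiSym.eq_one_or_neg_one
      (gcd_eq_one_of_not_dvd (hp j) (not_dvd_primeDisc hp hinj (Finset.ne_of_mem_erase hk).symm hi2))
  · rw [if_neg hji, redeiMatrix_apply_of_ne n p hji]
    by_cases hj2 : p j = 2
    · rw [hj2, kroneckerBit_primeDisc_two hp hi2]
      norm_cast
    · have ha : ((primeDisc n (p i) : ℤ) : ZMod (p j)) ≠ 0 := by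
        rw [Ne, ZMod.intCast_zmod_eq_zero_iff_dvd]
        exact not_dvd_primeDisc hp hinj hji hj2
      rw [kroneckerBit_eq_ite (hp j) hj2 ha, jacobiSym_primeDisc_eq hp hi2 (hp j) hj2]

end Tuple

end Literature.NumberTheory.QuadraticFields.RedeiReichardt

end
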